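import Summits.CriticalPhenomena.PercolationContinuityZ3.Theorems.Transplant.SkelPhiKits
import Summits.CriticalPhenomena.PercolationContinuityZ3.Theorems.Transplant.SkelPhiInputsFrame
import HarnessLib

/-!
# D″ node, LEVEL 1 (c) (DPRIME-SCOPE p3 addendum M, ruling 2026-08-21T04:56:47Z): the ROUTE DATUM of a near contact — the near branch of
# the per-contact hypothesis `hcon'` of the two-scale kit clause `Skelφ.kitClause'` DISCHARGED from the Step-I′ certificate
# (`Skelφ.exists_inputs_at_center`: the inputs hold at EVERY vertex, in particular at the kit centre `c = rectCtr …` behind the deep slab)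
# and a planar ROOM (band rectangle of the contact inside a planar region `Preg`, a half of its far side inside a planar core `Pcore`,
# e.g. `ChainPlanar.Band.core_routeR` read through the level box): zone at `c`, kit link at `c` (half ⊆ side), and the route link
# `∃ Qt Ft, Ft ⊆ T ∧ Qt ⊆ D ∧ Disjoint Ft (Λ c n) ∧ P_{Wt}(Λ c k ↔ Ft inside Qt) > 1 − δ₂` with `Qt` the fat band rectangle AT `c` and `Ft` the
# certified half of its far side, transferred to the subbox weighting `Wt` of the window graph

builds on p205010 (kernel theorem, internal audit signed; external expert review pending) — nothing in this file uses p205010.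
Lane `prim-bschramm`, seat `prim-bschramm-p1` (gen 9); helper file (`--supports stmt-CriticalPhenomena-4575 --as helper`).
* §1 **`zone_at_center`**, **`link_at_center`** (the Step-I′ inputs at any vertex, along either axis), `abs_sub_le_of_mem_rectPrism`;
* §2 **`fatSeqOff_kit_room`** (the `hkn`/`hΛρ` room facts of `kitClause'` for `Λc := fatSeqOff off`);
* §3 **`routeDatum`** (near contact: the three Step-IV inputs of `kitClause'` at the kit centre), **`kitCon_stepI`** (the whole per-contact
  dichotomy `hcon'` of `kitClause'`, far contacts sent to the target through their inner neighbour).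
[cite: KozmaNitzan2024, §4 Lemma 10 Step IV (pp. 20–21), Lemma 11 (pp. 22–23: the routes of the chain steps)]
-/

noncomputable section

open scoped Classical

namespace Summit.CriticalPhenomena.PercolationContinuityZ3.Theorems.Transplant

namespace Skelφ

open MeasureTheory
open Literature.Probability.Percolation Literature.Probability.LatticeModels SimpleGraph KNLevels
open Literature.Barriers.CriticalPhenomena (graphBall graphBall_finite mem_graphBall_self graphBall_mono)
open Skel (winGraph winGraph_adj winGraph_le KitGeom)
open SkelI (tanOff)
open Literature.Probability.Percolation.KozmaNitzan.Cells (oth oth_ne eq_oth_of_ne oth_oth)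

variable {V : Type} [DecidableEq V] {G : SimpleGraph V} [G.LocallyFinite] {φ : V → Site 2} {types : Finset V}

/-! ## §1 The Step-I′ inputs at any vertex, along either axis -/

section Inputs

variable [Countable V] (hfr : Frames G φ types) {p : unitInterval} (hC : CylSubcritical G φ types p) {D : StepI.Data V} {off : ℕ}
  (hD : D.Λ = fatSeqOff hfr hC off) {Sz Sx Sy : Finset ℕ} {q : unitInterval} {δ : ℝ}
  (h : ∀ i ∈ StepI.index types Sz Sx Sy, 1 - δ < (bondPercolation G q).real (StepI.event G φ D i))
include hD h

/-- **The uniqueness zone at any vertex**: under the Step-I′ certificate at the running density `q`, the zone of `D.Λ c` between `D.k` and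
any `M ∈ Sz` has probability `> 1 − δ` at EVERY vertex `c`. [cite: KozmaNitzan2024, §4 p. 20 ((23))] -/
theorem zone_at_center (c : V) {M : ℕ} (hM : M ∈ Sz) : 1 - δ < (bondPercolation G q).real (UniqZone.zone G (D.Λ c) D.k M) := by
  obtain ⟨t, -, hz, -, -⟩ := exists_inputs_at_center hfr hC hD h c
  have := hz M hM
  rwa [StepI.event_none] at this

/-- **The link inputs at any vertex along either axis**: under the Step-I′ certificate, for an extent `ℓ` certified along the axis `ax`
(`ℓ ∈ Sx` if `ax = 0`, `ℓ ∈ Sy` if `ax = 1`) the seed `D.Λ c D.k` is linked inside the fat band rectangle at `c` to each of the four halves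
`(ax, σ, τ)` of its far sides with probability `> 1 − δ`, at EVERY vertex `c`. [cite: KozmaNitzan2024, §4 p. 20 ((22)–(23))] -/
theorem link_at_center (c : V) (ax : Fin 2) {ℓ : ℕ} (hℓ0 : ax = 0 → ℓ ∈ Sx) (hℓ1 : ax = 1 → ℓ ∈ Sy) (σ τ : ℤˣ) :
    1 - δ < (bondPercolation G q).real
      (linkIn (rectPrism G φ c (StepI.widths D.Gb D.Fb ax ℓ) (D.R (amax (StepI.widths D.Gb D.Fb ax ℓ)))) (D.Λ c D.k)
        (rhalf G φ c (StepI.widths D.Gb D.Fb ax ℓ) (D.R (amax (StepI.widths D.Gb D.Fb ax ℓ))) ax (σ : ℤ) (τ : ℤ))) := by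
  obtain ⟨t, -, -, hx, hy⟩ := exists_inputs_at_center hfr hC hD h c
  by_cases hax : ax = 0
  · subst hax
    have := hx ℓ (hℓ0 rfl) σ τ
    rwa [StepI.event_some] at this
  · obtain rfl : ax = 1 := by rw [eq_oth_of_ne hax]; decide
    have := hy ℓ (hℓ1 rfl) σ τ
    rwa [StepI.event_some] at this

end Inputs

omit [DecidableEq V] [G.LocallyFinite] in
/-- Coordinates inside a fat rectangle: `|φ_i w − φ_i t| ≤ a_i`. [folklore] -/
theorem abs_sub_le_of_mem_rectPrism {t : V} {a : Fin 2 → ℕ} {R : ℕ} {w : V} (hw : w ∈ rectPrism G φ t a R) (i : Fin 2) :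
    |φ w i - φ t i| ≤ a i := by
  have hb := (mem_abox.1 (rectPrism_subset_rcyl G φ t a R hw)) i
  simp only [Pi.sub_apply] at hb
  exact abs_le.2 hb

/-! ## §2 The room facts of the shifted fat prisms -/

omit [DecidableEq V] in
/-- **The zone family `Λc := fatSeqOff off` meets the room hypotheses of `kitClause'`**: `Λc c k ⊆ Λc c n` for `k ≤ n`, and every vertex of
`Λc c n` lies in `B_G(c, ψ n + off)` and in the cylinder `φ c + Λ_n`. [cite: KozmaNitzan2024, §4 p. 16 (Lemma 9: the scales)] -/
theorem fatSeqOff_kit_room [Countable V] (hfr : Frames G φ types) {p : unitInterval} (hC : CylSubcritical G φ types p) (off : ℕ) {k n : ℕ}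
    (hkn : k ≤ n) :
    (∀ c, fatSeqOff hfr hC off c k ⊆ fatSeqOff hfr hC off c n) ∧
      ∀ c, ∀ z ∈ fatSeqOff hfr hC off c n, z ∈ graphBall G c (fatRadius hfr hC n + off) ∧ z ∈ cyl φ c n := by
  refine ⟨fun c => fatSeqOff_monotone hfr hC off c hkn, fun c z hz => ?_⟩
  have hz' := (mem_fatSeqOff_iff hfr hC off).1 hz
  refine ⟨?_, cylBall_subset_cyl G φ c n _ hz'⟩
  have hp := cylBall_subset_prism G φ c n _ hz'
  rw [prism_eq_prismAt, mem_prismAt] at hp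
  exact hp.1

/-! ## §3 The route datum of a near contact -/

section Datum

variable {w₀ : V} {R : ℕ} {lo hi : Site 2} {j ℓs M K r₀ : ℕ} {A : Fin 2 → Fin 2 → ℕ} {Rk : Fin 2 → ℕ}

/-- **THE ROUTE DATUM OF A NEAR CONTACT** (the near branch of `hcon'` of `Skelφ.kitClause'`, discharged). Under the Step-I′ certificate at the
running density `q` (threshold `1 − δ₂`; data `D` over the shifted fat prisms `D.Λ = fatSeqOff off`), a kit with zone scale `Mz ∈ Sz`, extents
`ℓK I` certified along each axis, half-widths `A I = widths (ℓK I)` and radii `Rk I = D.R (amax (A I))` fitting the slab room, and a ROUTE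
along the axis `ax` with sign `sg₀`: extents `ℓ ∈ [ℓ₀, ℓ₁]` certified along `ax`, beyond the zone scale (`Mz + 1 ≤ ℓ₀`) and within depth `r₀`
of the inner neighbour, and a planar room at every point of the level box (band rectangle in `Preg`, a half of its `sg₀`-side in `Pcore`) —
for every NEAR contact `x` of the window level, at the kit centre `c = rectCtr …` behind the deep slab: (i) the zone of `D.Λ c` between `D.k`
and `Mz`, (ii) the link from the seed `D.Λ c D.k` to the near side inside the kit rectangle, each with `P_q`-probability `> 1 − δ₂`, and
(iii) route sets `Qt = ` the fat band rectangle at `c`, `Ft = ` the certified half of its far side, with `Ft ⊆ T` (`T ⊇` the window over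
`Pcore`), `Qt ⊆ D` (`D ⊇` the window over `Preg`), `Ft` off the zone box `D.Λ c Mz`, and `P_{Wt}(D.Λ c D.k ↔ Ft inside Qt) > 1 − δ₂` under any
subbox weighting `Wt` of the window graph on `D`. [cite: KozmaNitzan2024, §4 Lemma 10 Step IV (pp. 20–21), Lemma 11 (pp. 22–23)] -/
theorem routeDatum [Countable V] (hlip : Lip G φ) (hstep : Steps G φ) (hfr : Frames G φ types) {p : unitInterval}
    (hC : CylSubcritical G φ types p) {D : StepI.Data V} {off : ℕ} (hD : D.Λ = fatSeqOff hfr hC off)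
    {Sz Sx Sy : Finset ℕ} {q : unitInterval} {δ₂ : ℝ}
    (h : ∀ i ∈ StepI.index types Sz Sx Sy, 1 - δ₂ < (bondPercolation G q).real (StepI.event G φ D i))
    -- the kit: zone scale, certified extents, half-widths, radii
    {Mz : ℕ} (hMz : Mz ∈ Sz) {ℓK : Fin 2 → ℕ} (hℓK0 : ∀ I, I = 0 → ℓK I ∈ Sx) (hℓK1 : ∀ I, I = 1 → ℓK I ∈ Sy)
    (hAw : ∀ I, A I = StepI.widths D.Gb D.Fb I (ℓK I)) (hRk : ∀ I, Rk I = D.R (amax (A I)))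
    -- the slab room of the kit rectangle
    (hwide : ∀ i, (lo - (j : Site 2)) i + 2 * tanOff ℓs M ≤ (hi + (j : Site 2)) i) (hA : ∀ i k, A i k ≤ M)
    (hK : ∀ i, ℓs + 1 + A i i + Rk i ≤ K) (hr₀ : ℓs + 1 + tanOff ℓs M + K ≤ r₀) (hR : r₀ ≤ R)
    -- the route: axis, sign, certified extents beyond the zone scale, depth
    (ax : Fin 2) {sg₀ : ℤ} (hsg₀ : sg₀ = 1 ∨ sg₀ = -1) {ℓ₀ ℓ₁ : ℕ} (hMℓ : Mz + 1 ≤ ℓ₀)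
    (hS0 : ax = 0 → ∀ ℓ, ℓ₀ ≤ ℓ → ℓ ≤ ℓ₁ → ℓ ∈ Sx) (hS1 : ax = 1 → ∀ ℓ, ℓ₀ ≤ ℓ → ℓ ≤ ℓ₁ → ℓ ∈ Sy)
    (hdepth : ∀ I ℓ, ℓ₀ ≤ ℓ → ℓ ≤ ℓ₁ → 2 * ℓs + 2 + tanOff ℓs M + A I I + D.R (amax (StepI.widths D.Gb D.Fb ax ℓ)) ≤ r₀)
    -- the planar room at every point of the level box
    {Preg Pcore : Finset (Site 2)}
    (hroom : ∀ v ∈ Finset.Icc (lo - (j : Site 2)) (hi + (j : Site 2)), ∃ ℓ : ℕ, ℓ₀ ≤ ℓ ∧ ℓ ≤ ℓ₁ ∧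
      (∀ y : Site 2, |y ax - v ax| ≤ ℓ → |y (oth ax) - v (oth ax)| ≤ StepI.widths D.Gb D.Fb ax ℓ (oth ax) → y ∈ Preg) ∧
      ∃ τ : ℤ, (τ = 1 ∨ τ = -1) ∧ ∀ y : Site 2, y ax - v ax = sg₀ * ℓ → 0 ≤ τ * (y (oth ax) - v (oth ax)) →
        |y (oth ax) - v (oth ax)| ≤ StepI.widths D.Gb D.Fb ax ℓ (oth ax) → y ∈ Pcore)
    -- the windows over the room inside the region / the target; the subbox weighting of the region
    {Dr T : Finset V} (hPD : Win G φ w₀ Preg R ⊆ Dr) (hPT : Win G φ w₀ Pcore R ⊆ T)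
    {Wt : Sym2 V → unitInterval} (hWD : IsSubbox (winGraph G w₀ R) Wt q Dr)
    -- the near contact
    {x : V} (hx : x ∈ outerBoundary (winGraph G w₀ R) (winLevel G φ w₀ R lo hi j))
    (hnear : inNbr G φ w₀ R (Finset.Icc (lo - (j : Site 2)) (hi + (j : Site 2))) x ∈ graphBall G w₀ (R - r₀)) :
    1 - δ₂ < (bondPercolation G q).real (UniqZone.zone G
        (D.Λ (rectCtr hstep (deepCtr G φ w₀ R (lo - (j : Site 2)) (hi + (j : Site 2)) ℓs M x)
          (exitDir G φ w₀ R (lo - (j : Site 2)) (hi + (j : Site 2)) x).1 (exitDir G φ w₀ R (lo - (j : Site 2)) (hi + (j : Site 2)) x).2 ℓs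
          (A (exitDir G φ w₀ R (lo - (j : Site 2)) (hi + (j : Site 2)) x).1))) D.k Mz) ∧
    1 - δ₂ < (bondPercolation G q).real (linkIn
        (rectPrism G φ (rectCtr hstep (deepCtr G φ w₀ R (lo - (j : Site 2)) (hi + (j : Site 2)) ℓs M x)
          (exitDir G φ w₀ R (lo - (j : Site 2)) (hi + (j : Site 2)) x).1 (exitDir G φ w₀ R (lo - (j : Site 2)) (hi + (j : Site 2)) x).2 ℓs
          (A (exitDir G φ w₀ R (lo - (j : Site 2)) (hi + (j : Site 2)) x).1))
          (A (exitDir G φ w₀ R (lo - (j : Site 2)) (hi + (j : Site 2)) x).1) (Rk (exitDir G φ w₀ R (lo - (j : Site 2)) (hi + (j : Site 2)) x).1))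
        (D.Λ (rectCtr hstep (deepCtr G φ w₀ R (lo - (j : Site 2)) (hi + (j : Site 2)) ℓs M x)
          (exitDir G φ w₀ R (lo - (j : Site 2)) (hi + (j : Site 2)) x).1 (exitDir G φ w₀ R (lo - (j : Site 2)) (hi + (j : Site 2)) x).2 ℓs
          (A (exitDir G φ w₀ R (lo - (j : Site 2)) (hi + (j : Site 2)) x).1)) D.k)
        (rectU hstep w₀ R lo hi j ℓs M A Rk x)) ∧
    ∃ Qt Ft : Finset V, Ft ⊆ T ∧ Qt ⊆ Dr ∧
      Disjoint Ft (D.Λ (rectCtr hstep (deepCtr G φ w₀ R (lo - (j : Site 2)) (hi + (j : Site 2)) ℓs M x)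
        (exitDir G φ w₀ R (lo - (j : Site 2)) (hi + (j : Site 2)) x).1 (exitDir G φ w₀ R (lo - (j : Site 2)) (hi + (j : Site 2)) x).2 ℓs
        (A (exitDir G φ w₀ R (lo - (j : Site 2)) (hi + (j : Site 2)) x).1)) Mz) ∧
      1 - δ₂ < (prodBernoulli Wt).real (linkIn (↑Qt)
        (D.Λ (rectCtr hstep (deepCtr G φ w₀ R (lo - (j : Site 2)) (hi + (j : Site 2)) ℓs M x)
          (exitDir G φ w₀ R (lo - (j : Site 2)) (hi + (j : Site 2)) x).1 (exitDir G φ w₀ R (lo - (j : Site 2)) (hi + (j : Site 2)) x).2 ℓs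
          (A (exitDir G φ w₀ R (lo - (j : Site 2)) (hi + (j : Site 2)) x).1)) D.k) Ft) := by
  -- the geometry of the near contact: inner neighbour `y`, deep centre `t`, kit centre `c`
  have hx' : x ∈ outerBoundary (winGraph G w₀ R) (Win G φ w₀ (Finset.Icc (lo - (j : Site 2)) (hi + (j : Site 2))) R) := hx
  obtain ⟨-, -, hyP⟩ := inNbr_spec hx'
  have hty := (deepCtr_spec hstep (ℓs := ℓs) (M := M) hwide hyP).1
  have htw := BoxProdZ2.mem_graphBall_add G hnear hty
  have hrectS := rectPrism_subset_shellWin hlip hstep hwide hA hK hr₀ hR hx hnear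
  have hrectU : rectU hstep w₀ R lo hi j ℓs M A Rk x =
      nearSide G hstep (deepCtr G φ w₀ R (lo - (j : Site 2)) (hi + (j : Site 2)) ℓs M x)
        (exitDir G φ w₀ R (lo - (j : Site 2)) (hi + (j : Site 2)) x).1 (exitDir G φ w₀ R (lo - (j : Site 2)) (hi + (j : Site 2)) x).2 ℓs
        (A (exitDir G φ w₀ R (lo - (j : Site 2)) (hi + (j : Site 2)) x).1) (Rk (exitDir G φ w₀ R (lo - (j : Site 2)) (hi + (j : Site 2)) x).1) :=
    rfl
  rw [hrectU]
  generalize (exitDir G φ w₀ R (lo - (j : Site 2)) (hi + (j : Site 2)) x).1 = I at hrectS ⊢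
  generalize (exitDir G φ w₀ R (lo - (j : Site 2)) (hi + (j : Site 2)) x).2 = sg at hrectS ⊢
  generalize deepCtr G φ w₀ R (lo - (j : Site 2)) (hi + (j : Site 2)) ℓs M x = t at hrectS htw ⊢
  set c : V := rectCtr hstep t I sg ℓs (A I) with hc
  have hcw : c ∈ graphBall G w₀ (R - r₀ + (ℓs + 1 + tanOff ℓs M) + (ℓs + 1 + A I I)) :=
    BoxProdZ2.mem_graphBall_add G htw (rectCtr_mem_graphBall hstep t I sg ℓs (A I))
  have hcP : φ c ∈ Finset.Icc (lo - (j : Site 2)) (hi + (j : Site 2)) :=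
    SkelI.mem_Icc_of_mem_shell ((mem_Win G φ).1 (hrectS ((mem_rectPrismFin G φ).2 (self_mem_rectPrism G φ c (A I) (Rk I))))).2
  refine ⟨zone_at_center hfr hC hD h c hMz, ?_, ?_⟩
  · -- (ii) the kit link at `c`: the certified half lies in the near side
    have hl := link_at_center hfr hC hD h c I (hℓK0 I) (hℓK1 I) sg 1
    rw [← hAw I, ← hRk I] at hl
    exact hl.trans_le (StepI.real_linkIn_rside_ge_rhalf q c (A I) (Rk I) (D.Λ c D.k) I (sg : ℤ) ((1 : ℤˣ) : ℤ))
  · -- (iii) the route from `c`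
    obtain ⟨ℓ, hℓ0, hℓ1, hrect, τ, hτ, hhalf⟩ := hroom (φ c) hcP
    obtain ⟨σu, hσu⟩ : ∃ u : ℤˣ, (u : ℤ) = sg₀ := by
      rcases hsg₀ with h0 | h0
      · exact ⟨1, by rw [h0, Units.val_one]⟩
      · exact ⟨-1, by rw [h0, Units.val_neg, Units.val_one]⟩
    obtain ⟨τu, hτu⟩ : ∃ u : ℤˣ, (u : ℤ) = τ := by
      rcases hτ with h0 | h0
      · exact ⟨1, by rw [h0, Units.val_one]⟩
      · exact ⟨-1, by rw [h0, Units.val_neg, Units.val_one]⟩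
    have hev := link_at_center hfr hC hD h c ax (fun h0 => hS0 h0 ℓ hℓ0 hℓ1) (fun h1 => hS1 h1 ℓ hℓ0 hℓ1) σu τu
    rw [hσu, hτu] at hev
    have hdep := hdepth I ℓ hℓ0 hℓ1
    set a : Fin 2 → ℕ := StepI.widths D.Gb D.Fb ax ℓ with ha
    set Rt : ℕ := D.R (amax a) with hRt
    have haax : a ax = ℓ := by rw [ha, StepI.widths_self]
    -- depth: the fat band rectangle at `c` lies in the window ball
    have hQB : ∀ w ∈ rectPrism G φ c a Rt, w ∈ graphBall G w₀ R := fun w hw =>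
      graphBall_mono G w₀ (by omega) (BoxProdZ2.mem_graphBall_add G hcw (rectPrism_subset_graphBall G φ c a Rt hw))
    -- planar room: the fat band rectangle lies in the window over `Preg`
    have hQD : rectPrismFin G φ c a Rt ⊆ Dr := fun w hw => by
      have hwQ := (mem_rectPrismFin G φ).1 hw
      have h1 := abs_sub_le_of_mem_rectPrism hwQ ax
      rw [haax] at h1
      exact hPD ((mem_Win G φ).2 ⟨hQB w hwQ, hrect (φ w) h1 (abs_sub_le_of_mem_rectPrism hwQ (oth ax))⟩)
    refine ⟨rectPrismFin G φ c a Rt, rhalf G φ c a Rt ax sg₀ τ, fun w hw => ?_, hQD, ?_, ?_⟩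
    · -- `Ft ⊆ T`: the certified half lies in the window over `Pcore`
      obtain ⟨hwQ, h1, h2⟩ := (mem_rhalf G φ).1 hw
      rw [haax] at h1
      exact hPT ((mem_Win G φ).2 ⟨hQB w hwQ, hhalf (φ w) h1 h2 (abs_sub_le_of_mem_rectPrism hwQ (oth ax))⟩)
    · -- `Ft` is off the zone box: its `ax`-coordinate is `ℓ > Mz` away from `φ c`
      rw [hD]
      refine Finset.disjoint_left.2 fun w hw hz => ?_
      obtain ⟨-, h1, -⟩ := (mem_rhalf G φ).1 hw
      rw [haax] at h1
      have hzc := fatSeqOff_subset_cyl hfr hC off c Mz (Finset.mem_coe.2 hz)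
      rw [mem_cyl, mem_box] at hzc
      have h3 := hzc ax
      simp only [Pi.sub_apply] at h3
      have hℓM : (Mz : ℤ) + 1 ≤ ℓ := by exact_mod_cast hMℓ.trans hℓ0
      rcases hsg₀ with h0 | h0 <;> rw [h0] at h1 <;> linarith [h3.1, h3.2]
    · -- the route link, transferred to the subbox weighting of the window graph
      have heq := Skel.real_eq_of_isSubbox_of_le (winGraph_le G w₀ R) hWD hQD
        (Skel.adj_winGraph_of_subset_graphBall fun v hv => hQB v ((mem_rectPrismFin G φ).1 hv))
        (determinedBy_linkIn (↑(rectPrismFin G φ c a Rt)) (D.Λ c D.k) (rhalf G φ c a Rt ax sg₀ τ) subset_rfl)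
        (measurableSet_linkIn _ _ _)
      rw [heq, coe_rectPrismFin]
      exact hev

/-- **THE PER-CONTACT DICHOTOMY `hcon'` OF `kitClause'`, DISCHARGED** (route datum + far contacts): a FAR contact (inner neighbour off
`B_G(w₀, R − r₀)`) is served by its inner neighbour, required to lie in the target (the rim part of the enlarged target); a NEAR contact by
`routeDatum`. The conclusion is literally the hypothesis `hcon'` of `Skelφ.kitClause'` with `Λc := D.Λ`, `kz := D.k`, `n := Mz`.
[cite: KozmaNitzan2024, §4 Lemma 10 Step IV (pp. 20–21), Lemma 11 (pp. 22–23)] -/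
theorem kitCon_stepI [Countable V] (hlip : Lip G φ) (hstep : Steps G φ) (hfr : Frames G φ types) {p : unitInterval}
    (hC : CylSubcritical G φ types p) {D : StepI.Data V} {off : ℕ} (hD : D.Λ = fatSeqOff hfr hC off)
    {Sz Sx Sy : Finset ℕ} {q : unitInterval} {δ₂ : ℝ}
    (h : ∀ i ∈ StepI.index types Sz Sx Sy, 1 - δ₂ < (bondPercolation G q).real (StepI.event G φ D i))
    {Mz : ℕ} (hMz : Mz ∈ Sz) {ℓK : Fin 2 → ℕ} (hℓK0 : ∀ I, I = 0 → ℓK I ∈ Sx) (hℓK1 : ∀ I, I = 1 → ℓK I ∈ Sy)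
    (hAw : ∀ I, A I = StepI.widths D.Gb D.Fb I (ℓK I)) (hRk : ∀ I, Rk I = D.R (amax (A I)))
    (hwide : ∀ i, (lo - (j : Site 2)) i + 2 * tanOff ℓs M ≤ (hi + (j : Site 2)) i) (hA : ∀ i k, A i k ≤ M)
    (hK : ∀ i, ℓs + 1 + A i i + Rk i ≤ K) (hr₀ : ℓs + 1 + tanOff ℓs M + K ≤ r₀) (hR : r₀ ≤ R)
    (ax : Fin 2) {sg₀ : ℤ} (hsg₀ : sg₀ = 1 ∨ sg₀ = -1) {ℓ₀ ℓ₁ : ℕ} (hMℓ : Mz + 1 ≤ ℓ₀)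
    (hS0 : ax = 0 → ∀ ℓ, ℓ₀ ≤ ℓ → ℓ ≤ ℓ₁ → ℓ ∈ Sx) (hS1 : ax = 1 → ∀ ℓ, ℓ₀ ≤ ℓ → ℓ ≤ ℓ₁ → ℓ ∈ Sy)
    (hdepth : ∀ I ℓ, ℓ₀ ≤ ℓ → ℓ ≤ ℓ₁ → 2 * ℓs + 2 + tanOff ℓs M + A I I + D.R (amax (StepI.widths D.Gb D.Fb ax ℓ)) ≤ r₀)
    {Preg Pcore : Finset (Site 2)}
    (hroom : ∀ v ∈ Finset.Icc (lo - (j : Site 2)) (hi + (j : Site 2)), ∃ ℓ : ℕ, ℓ₀ ≤ ℓ ∧ ℓ ≤ ℓ₁ ∧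
      (∀ y : Site 2, |y ax - v ax| ≤ ℓ → |y (oth ax) - v (oth ax)| ≤ StepI.widths D.Gb D.Fb ax ℓ (oth ax) → y ∈ Preg) ∧
      ∃ τ : ℤ, (τ = 1 ∨ τ = -1) ∧ ∀ y : Site 2, y ax - v ax = sg₀ * ℓ → 0 ≤ τ * (y (oth ax) - v (oth ax)) →
        |y (oth ax) - v (oth ax)| ≤ StepI.widths D.Gb D.Fb ax ℓ (oth ax) → y ∈ Pcore)
    {Dr T : Finset V} (hPD : Win G φ w₀ Preg R ⊆ Dr) (hPT : Win G φ w₀ Pcore R ⊆ T)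
    {Wt : Sym2 V → unitInterval} (hWD : IsSubbox (winGraph G w₀ R) Wt q Dr)
    -- far contacts: the inner neighbour lies in the target
    (hfarT : ∀ x ∈ outerBoundary (winGraph G w₀ R) (winLevel G φ w₀ R lo hi j),
      inNbr G φ w₀ R (Finset.Icc (lo - (j : Site 2)) (hi + (j : Site 2))) x ∉ graphBall G w₀ (R - r₀) →
      inNbr G φ w₀ R (Finset.Icc (lo - (j : Site 2)) (hi + (j : Site 2))) x ∈ T) (R' : ℕ) :
    ∀ x ∈ outerBoundary (winGraph G w₀ R) (winLevel G φ w₀ R lo hi j),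
      (∃ u ∈ (slabGeomDeep G φ w₀ R lo hi j ℓs M R' r₀ (rectU hstep w₀ R lo hi j ℓs M A Rk)).U x, u ∈ T) ∨
      (inNbr G φ w₀ R (Finset.Icc (lo - (j : Site 2)) (hi + (j : Site 2))) x ∈ graphBall G w₀ (R - r₀) ∧
        1 - δ₂ < (bondPercolation G q).real (UniqZone.zone G
          (D.Λ (rectCtr hstep (deepCtr G φ w₀ R (lo - (j : Site 2)) (hi + (j : Site 2)) ℓs M x)
            (exitDir G φ w₀ R (lo - (j : Site 2)) (hi + (j : Site 2)) x).1 (exitDir G φ w₀ R (lo - (j : Site 2)) (hi + (j : Site 2)) x).2 ℓs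
            (A (exitDir G φ w₀ R (lo - (j : Site 2)) (hi + (j : Site 2)) x).1))) D.k Mz) ∧
        1 - δ₂ < (bondPercolation G q).real (linkIn
          (rectPrism G φ (rectCtr hstep (deepCtr G φ w₀ R (lo - (j : Site 2)) (hi + (j : Site 2)) ℓs M x)
            (exitDir G φ w₀ R (lo - (j : Site 2)) (hi + (j : Site 2)) x).1 (exitDir G φ w₀ R (lo - (j : Site 2)) (hi + (j : Site 2)) x).2 ℓs
            (A (exitDir G φ w₀ R (lo - (j : Site 2)) (hi + (j : Site 2)) x).1))
            (A (exitDir G φ w₀ R (lo - (j : Site 2)) (hi + (j : Site 2)) x).1) (Rk (exitDir G φ w₀ R (lo - (j : Site 2)) (hi + (j : Site 2)) x).1))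
          (D.Λ (rectCtr hstep (deepCtr G φ w₀ R (lo - (j : Site 2)) (hi + (j : Site 2)) ℓs M x)
            (exitDir G φ w₀ R (lo - (j : Site 2)) (hi + (j : Site 2)) x).1 (exitDir G φ w₀ R (lo - (j : Site 2)) (hi + (j : Site 2)) x).2 ℓs
            (A (exitDir G φ w₀ R (lo - (j : Site 2)) (hi + (j : Site 2)) x).1)) D.k)
          (rectU hstep w₀ R lo hi j ℓs M A Rk x)) ∧
        ∃ Qt Ft : Finset V, Ft ⊆ T ∧ Qt ⊆ Dr ∧
          Disjoint Ft (D.Λ (rectCtr hstep (deepCtr G φ w₀ R (lo - (j : Site 2)) (hi + (j : Site 2)) ℓs M x)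
            (exitDir G φ w₀ R (lo - (j : Site 2)) (hi + (j : Site 2)) x).1 (exitDir G φ w₀ R (lo - (j : Site 2)) (hi + (j : Site 2)) x).2 ℓs
            (A (exitDir G φ w₀ R (lo - (j : Site 2)) (hi + (j : Site 2)) x).1)) Mz) ∧
          1 - δ₂ < (prodBernoulli Wt).real (linkIn (↑Qt)
            (D.Λ (rectCtr hstep (deepCtr G φ w₀ R (lo - (j : Site 2)) (hi + (j : Site 2)) ℓs M x)
              (exitDir G φ w₀ R (lo - (j : Site 2)) (hi + (j : Site 2)) x).1 (exitDir G φ w₀ R (lo - (j : Site 2)) (hi + (j : Site 2)) x).2 ℓs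
              (A (exitDir G φ w₀ R (lo - (j : Site 2)) (hi + (j : Site 2)) x).1)) D.k) Ft)) := by
  intro x hx
  by_cases hnear : inNbr G φ w₀ R (Finset.Icc (lo - (j : Site 2)) (hi + (j : Site 2))) x ∈ graphBall G w₀ (R - r₀)
  · exact Or.inr ⟨hnear, routeDatum hlip hstep hfr hC hD h hMz hℓK0 hℓK1 hAw hRk hwide hA hK hr₀ hR ax hsg₀ hMℓ hS0 hS1 hdepth
      hroom hPD hPT hWD hx hnear⟩
  · refine Or.inl ⟨inNbr G φ w₀ R (Finset.Icc (lo - (j : Site 2)) (hi + (j : Site 2))) x, ?_, hfarT x hx hnear⟩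
    simp [slabGeomDeep, hnear]

end Datum

end Skelφ

end Summit.CriticalPhenomena.PercolationContinuityZ3.Theorems.Transplant

end
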